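import Mathlib
import Summits.NavierStokesRegularity.NavierStokesRegularity.Theses.UnthreadedDoor
import Summits.NavierStokesRegularity.NavierStokesRegularity.Theorems.UnthreadedDoorTargetOfTypeIHalf
import Summits.NavierStokesRegularity.NavierStokesRegularity.Theorems.UnthreadedDoorIndicatrixTypeIHalfOfResidue
import Summits.NavierStokesRegularity.NavierStokesRegularity.Theorems.UnthreadedDoorIndicatrixLeHessian
import HarnessLib

/-!
# TargetOfTypeIHalf — v2: **LANDED** as `Theorems/UnthreadedDoorTargetOfTypeIHalf.lean` (p733603, eng-4 g10, 2026-08-29; per NS STEWARD p128 (1))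

This planner workfile (ns-idea-14 g13, custodian of ⟨1222⟩; v1 = commit 1607a04f48e6, rc 0 · 0 sorry) is now a **POINTER**: its two statements
`hasTypeITimeDecay_shift` and `unthreadedDoor_target_of_poloidalLiouvilleTypeI` live, with identical statements and proofs, in the accepted theorem file
`Theorems/UnthreadedDoorTargetOfTypeIHalf.lean` (tree sha16 24d8e48eb6472c55, namespace `Summit.NavierStokesRegularity.NavierStokesRegularity.Theorems`),
and are only RE-CHECKED here by name (the `example`s below; this file declares nothing).

OBSERVATION (unchanged).  The route's deciding theorem `Theses.UnthreadedDoor.closes (hZ) (hS) (hP : PoloidalLiouville) (hE) : Target` applies `hP` only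
to the time-shifted zoom limit of a `v` carrying `HasTypeITimeDecay C v`; Type-I decay survives the backward shift, so the Type-I half C⁻ of W1 ALONE gives
`Target` — `Theorems.unthreadedDoor_target_of_poloidalLiouvilleTypeI` (p733603).  With ARM A g8's p731994 and eng-4 g9's p732125 (Λ-0b+c ⟸ the
Polterovich–Sodin fact) the last `example` certifies BY NAME:

  **`UnthreadedDoor.Target` ⟸ {`VandendriesMiller1994_realAnExp_isOMinimal`, `PolterovichSodin2007_indicatrix_sphere` (two registered Literature facts),
  Λ-1 `HeadClusterRuleTame`, Λ-2 `ClusterFluxOneSidedLawTame`, Σ-0bR₂ `ClusterFluxNearCentreLipschitz`}** — three OPEN statements (IndicatrixSketch v1.7.10 §3;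
  CellFluxSketch v1.2.18 for Σ-0bR₂'s partial results and tame twin) instead of the XL wall W1 as typed.

STATUS OF THE CONSEQUENCE.  NS STEWARD p128 (2), 2026-08-29T16:32Z: the route re-glue (`closes` taking C⁻ or its residue items instead of `hP`) is DEFERRED
to the weekly steward as a D-0171 tag-change candidate «UnthreadedDoor.Target ⟸ {VandendriesMiller fact, PS07 fact, Λ-1, Λ-2, Σ-0bR₂} by name»; `closes` is
UNCHANGED; this seat opens / edits no routes.
HONEST LABEL: bookkeeping; `Target` (rung N0-LocalTubeDoorUnthreaded, a LOCAL Type-I door statement) is NOT proved — it is proved CONDITIONALLY on three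
open items + two registered facts; ⟨1222⟩ `PoloidalLiouville` stays OPEN and is NOT implied by C⁻; NS regularity is NOT proved.
-/

noncomputable section

namespace Summit.NavierStokesRegularity.NavierStokesRegularity.Cruxes.PoloidalLiouville.TargetOfTypeIHalf

open Summit.NavierStokesRegularity.NavierStokesRegularity.Theses.UnthreadedDoor
open Summit.NavierStokesRegularity.NavierStokesRegularity.Theorems
open Literature.Analysis.FluidPDE MeasureTheory
open Summit.NavierStokesRegularity.NavierStokesRegularity.Theorems.PoloidalLiouville.NetFlux (E3)

/-- Pointer: the shift lemma, by name (p733603). -/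
example {C δ : ℝ} {v : ℝ → E3 → E3} (hv : HasTypeITimeDecay C v) (hδ : 0 ≤ δ) :
    HasTypeITimeDecay C (fun s x => v (s - δ) x) :=
  hasTypeITimeDecay_shift hv hδ

/-- Pointer: **C⁻ alone gives the door's `Target`**, by name (p733603). -/
example
    (hP : ∀ v : ℝ → E3 → E3,
      ((∃ C : ℝ, HasTypeITimeDecay C v) ∧ IsBoundedAncientMildSolution 1 v ∧
        (∀ t < 0, AEStronglyMeasurable (v t) volume) ∧
        ContDiffOn ℝ (⊤ : ℕ∞) (Function.uncurry v) (Set.Iio 0 ×ˢ Set.univ) ∧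
        ∃ x₀ : E3, ∀ t < 0, ∀ x, inner ℝ (x - x₀) (curl (v t) x) = 0) →
      ∀ t < 0, ∃ b : E3, ∀ x, v t x = b) :
    Target :=
  unthreadedDoor_target_of_poloidalLiouvilleTypeI hP

/-- **By-name certificate (the steward's D-0171 candidate): `Target` ⟸ {hO, hPS, Λ-1, Λ-2, Σ-0bR₂}** — p733603 ∘ p731994 ∘ p732125; the binder types are
those of `PoloidalLiouville.Indicatrix.poloidalLiouvilleTypeI_of_indicatrixResidue` (Λ-1, Λ-2, Σ-0bR₂ spelled out there) and of the two Literature facts. -/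
example := fun hO hPS h1 h2 hR₂ =>
  unthreadedDoor_target_of_poloidalLiouvilleTypeI
    (PoloidalLiouville.Indicatrix.poloidalLiouvilleTypeI_of_indicatrixResidue hO h1 h2
      (PoloidalLiouville.Indicatrix.indicatrixLeHessian_of hPS) hR₂)

end Summit.NavierStokesRegularity.NavierStokesRegularity.Cruxes.PoloidalLiouville.TargetOfTypeIHalf

end
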